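import Mathlib
import Literature.Barriers.MatrixMultiplication.QuasirandomBarrier
import Literature.Barriers.MatrixMultiplication.QuasirandomBarrierProofs
import Literature.Combinatorics.Additive.TripleProductProperty
import Summits.MatrixMultiplication.MatrixMultiplication.Theses.GLnSeparatingDesigns

/-!
# The finite-field shadow `|S||T||U| ≤ 2 p^(3n²/2 − (n−1)/2)` for TPP triples in `GL_n(𝔽_p)`

Stub `stub_finiteFieldShadow` of line `Ideate5Sketch` (crux `BorderHalfDimensionDesigns`, item
stmt-MatrixMultiplication-18360, route `GLnSeparatingDesigns`; barrier note B14).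

In `G = GL_n(𝔽_p)` with `p ≥ 5`, `n ≥ 3`, every triple `S, T, U ⊆ G` with the triple product property
has `|S||T||U| ≤ 2 · p^(3n²/2 − (n−1)/2)`.  Ingredients:
* BCGPU 2023, Thm. 3.2 (the tree's `BCGPU2023_thm32_holds`, proved):
  `|S||T||U| ≤ |G|^{3/2}/√n(G) + |G|` for every finite non-abelian `G`;
* the hypothesis `hmin` (the cited minimal degree of `GL_n(𝔽_p)`): `p^(n−1) ≤ n(G)`;
* `|GL_n(𝔽_p)| ≤ p^(n²)` (the units of the matrix ring inject into the `p^(n²)` matrices);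
* `GL_n(R)` is non-abelian for `n ≥ 2` over a nontrivial commutative ring (two elementary
  transvections `t_{ij}(1)`, `t_{ji}(1)` do not commute).
Then `|G|^{3/2}/√n(G) ≤ p^(3n²/2)/p^((n−1)/2)` and `|G| ≤ p^(n²) ≤ p^(3n²/2 − (n−1)/2)`.
-/

set_option linter.dupNamespace false

open scoped BigOperators Matrix

namespace Summit.MatrixMultiplication.MatrixMultiplication.Theorems.BorderHalfDimensionDesigns

/-- Over a nontrivial commutative ring, `GL_n(R)` is non-abelian as soon as `2 ≤ n`: for `i ≠ j` the
elementary transvections `t_{ij}(1)` and `t_{ji}(1)` (units, with inverses `t_{ij}(-1)`, `t_{ji}(-1)`)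
satisfy `(t_{ij}(1) t_{ji}(1))_{ii} = 2` but `(t_{ji}(1) t_{ij}(1))_{ii} = 1`. [folklore] -/
theorem ffShadow_GL_exists_mul_ne_mul {R : Type*} [CommRing R] [Nontrivial R] {n : ℕ}
    (hn : 2 ≤ n) : ∃ a b : Matrix.GeneralLinearGroup (Fin n) R, a * b ≠ b * a := by
  haveI : Nontrivial (Fin n) := Fin.nontrivial_iff_two_le.2 hn
  obtain ⟨i, j, hij⟩ := exists_pair_ne (Fin n)
  refine ⟨⟨Matrix.transvection i j 1, Matrix.transvection i j (-1), ?_, ?_⟩,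
    ⟨Matrix.transvection j i 1, Matrix.transvection j i (-1), ?_, ?_⟩, fun h => ?_⟩
  · rw [Matrix.transvection_mul_transvection_same i j hij, add_neg_cancel, Matrix.transvection_zero]
  · rw [Matrix.transvection_mul_transvection_same i j hij, neg_add_cancel, Matrix.transvection_zero]
  · rw [Matrix.transvection_mul_transvection_same j i hij.symm, add_neg_cancel,
      Matrix.transvection_zero]
  · rw [Matrix.transvection_mul_transvection_same j i hij.symm, neg_add_cancel,
      Matrix.transvection_zero]
  · -- compare the `(i, i)` entries of the two products
    have h' := congrArg (fun g : Matrix.GeneralLinearGroup (Fin n) R =>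
      (g : Matrix (Fin n) (Fin n) R) i i) h
    simp only [Units.val_mul, Matrix.transvection_mul_apply_same,
      Matrix.transvection_mul_apply_of_ne j i i i hij] at h'
    simp [Matrix.transvection, hij.symm] at h'

/-- `|GL_n(𝔽_p)| ≤ p^(n²)`: the units of `M_n(𝔽_p)` inject (via `Units.val`) into the `p^(n·n)`
matrices. [folklore] -/
theorem ffShadow_card_GL_le (p n : ℕ) [Fact p.Prime] :
    Fintype.card (Matrix.GeneralLinearGroup (Fin n) (ZMod p)) ≤ p ^ (n * n) := by
  calc Fintype.card (Matrix.GeneralLinearGroup (Fin n) (ZMod p))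
      ≤ Fintype.card (Matrix (Fin n) (Fin n) (ZMod p)) :=
        Fintype.card_le_of_injective _ Units.val_injective
    _ = p ^ (n * n) := by
        change Fintype.card (Fin n → Fin n → ZMod p) = _
        rw [Fintype.card_fun, Fintype.card_fun, ZMod.card, Fintype.card_fin, ← pow_mul]

/-- STUB D of line `Ideate5Sketch` — **finite-field shadow of the crux below `ε = 1/6`** (barrier
note B14): BCGPU 2023 Thm. 3.2 (`BCGPU2023_thm32_holds`, tree) in the non-abelian group
`G = GL_n(𝔽_p)` (`n ≥ 3`), combined with the cited minimal degree `n(GL_n(𝔽_p)) ≥ p^(n−1)`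
(`p ≥ 5`, `n ≥ 3`; Tiep–Zalesskii 1996 / Landazuri–Seitz 1974, taken as the hypothesis `hmin`) and
`|GL_n(𝔽_p)| ≤ p^(n²)`, gives `|S||T||U| ≤ |G|^{3/2}/√n(G) + |G| ≤ p^(3n²/2)/p^((n−1)/2) + p^(n²)
≤ 2 · p^(3n²/2 − (n−1)/2)` for every TPP triple `S, T, U ⊆ GL_n(𝔽_p)`.
[cite: BlasiakCohnGrochowPrattUmans2023, Thm. 3.2] -/
theorem stub_finiteFieldShadow
    (hmin : ∀ (p n : ℕ) [Fact p.Prime], 5 ≤ p → 3 ≤ n →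
      (p : ℝ) ^ ((n : ℝ) - 1) ≤
        (Literature.Barriers.MatrixMultiplication.secondCharDegree
          (Matrix.GeneralLinearGroup (Fin n) (ZMod p)) : ℝ)) :
    ∀ (p n : ℕ) [Fact p.Prime], 5 ≤ p → 3 ≤ n →
      ∀ S T U : Finset (Matrix.GeneralLinearGroup (Fin n) (ZMod p)),
        Literature.Combinatorics.Additive.TripleProductProperty S T U →
          ((S.card * T.card * U.card : ℕ) : ℝ) ≤
            2 * (p : ℝ) ^ ((3 : ℝ) * (n : ℝ) ^ 2 / 2 - ((n : ℝ) - 1) / 2) := by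
  intro p n hprime hp hn S T U htpp
  -- BCGPU 2023, Thm. 3.2 in the non-abelian finite group `G = GL_n(𝔽_p)`
  have h32 := Literature.Barriers.MatrixMultiplication.BCGPU2023_thm32_holds
    (Matrix.GeneralLinearGroup (Fin n) (ZMod p)) (ffShadow_GL_exists_mul_ne_mul (by omega))
    S T U htpp
  have hdeg := hmin p n hp hn
  have hP0 : (0 : ℝ) < (p : ℝ) := by exact_mod_cast (show 0 < p by omega)
  have hP1 : (1 : ℝ) ≤ (p : ℝ) := by exact_mod_cast (show 1 ≤ p by omega)
  have hN3 : (3 : ℝ) ≤ (n : ℝ) := by exact_mod_cast hn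
  -- `|G| ≤ p^(n²)`
  have hG0 : (0 : ℝ) ≤ (Fintype.card (Matrix.GeneralLinearGroup (Fin n) (ZMod p)) : ℝ) :=
    Nat.cast_nonneg _
  have hG : (Fintype.card (Matrix.GeneralLinearGroup (Fin n) (ZMod p)) : ℝ) ≤
      (p : ℝ) ^ ((n : ℝ) ^ 2) := by
    have h : ((Fintype.card (Matrix.GeneralLinearGroup (Fin n) (ZMod p)) : ℕ) : ℝ) ≤
        ((p ^ (n * n) : ℕ) : ℝ) := by
      exact_mod_cast ffShadow_card_GL_le p n
    have hcast : ((p ^ (n * n) : ℕ) : ℝ) = (p : ℝ) ^ ((n : ℝ) ^ 2) := by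
      rw [Nat.cast_pow, ← Real.rpow_natCast]
      congr 1
      push_cast
      ring
    rwa [hcast] at h
  -- numerator `|G|^{3/2} ≤ p^(3n²/2)`
  have hnum : (Fintype.card (Matrix.GeneralLinearGroup (Fin n) (ZMod p)) : ℝ) ^ (3 / 2 : ℝ) ≤
      (p : ℝ) ^ ((n : ℝ) ^ 2 * (3 / 2)) := by
    rw [Real.rpow_mul hP0.le]
    exact Real.rpow_le_rpow hG0 hG (by norm_num)
  -- denominator `p^((n−1)/2) ≤ √n(G)`
  have hden : (p : ℝ) ^ (((n : ℝ) - 1) / 2) ≤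
      Real.sqrt (Literature.Barriers.MatrixMultiplication.secondCharDegree
        (Matrix.GeneralLinearGroup (Fin n) (ZMod p)) : ℝ) := by
    have hsq : (p : ℝ) ^ (((n : ℝ) - 1) / 2) = Real.sqrt ((p : ℝ) ^ ((n : ℝ) - 1)) := by
      rw [Real.sqrt_eq_rpow, ← Real.rpow_mul hP0.le]
      congr 1
      ring
    rw [hsq]
    exact Real.sqrt_le_sqrt hdeg
  have hden0 : (0 : ℝ) < (p : ℝ) ^ (((n : ℝ) - 1) / 2) := Real.rpow_pos_of_pos hP0 _
  -- first term
  have h1 : (Fintype.card (Matrix.GeneralLinearGroup (Fin n) (ZMod p)) : ℝ) ^ (3 / 2 : ℝ) /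
      Real.sqrt (Literature.Barriers.MatrixMultiplication.secondCharDegree
        (Matrix.GeneralLinearGroup (Fin n) (ZMod p)) : ℝ) ≤
      (p : ℝ) ^ ((3 : ℝ) * (n : ℝ) ^ 2 / 2 - ((n : ℝ) - 1) / 2) := by
    calc (Fintype.card (Matrix.GeneralLinearGroup (Fin n) (ZMod p)) : ℝ) ^ (3 / 2 : ℝ) /
          Real.sqrt (Literature.Barriers.MatrixMultiplication.secondCharDegree
            (Matrix.GeneralLinearGroup (Fin n) (ZMod p)) : ℝ)
        ≤ (p : ℝ) ^ ((n : ℝ) ^ 2 * (3 / 2)) / (p : ℝ) ^ (((n : ℝ) - 1) / 2) :=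
          div_le_div₀ (Real.rpow_nonneg hP0.le _) hnum hden0 hden
      _ = (p : ℝ) ^ ((3 : ℝ) * (n : ℝ) ^ 2 / 2 - ((n : ℝ) - 1) / 2) := by
          rw [← Real.rpow_sub hP0]
          congr 1
          ring
  -- second term
  have hexp : (n : ℝ) ^ 2 ≤ (3 : ℝ) * (n : ℝ) ^ 2 / 2 - ((n : ℝ) - 1) / 2 := by
    nlinarith [hN3, sq_nonneg ((n : ℝ) - 1)]
  have h2 : (Fintype.card (Matrix.GeneralLinearGroup (Fin n) (ZMod p)) : ℝ) ≤
      (p : ℝ) ^ ((3 : ℝ) * (n : ℝ) ^ 2 / 2 - ((n : ℝ) - 1) / 2) :=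
    hG.trans (Real.rpow_le_rpow_of_exponent_le hP1 hexp)
  calc ((S.card * T.card * U.card : ℕ) : ℝ)
      ≤ (Fintype.card (Matrix.GeneralLinearGroup (Fin n) (ZMod p)) : ℝ) ^ (3 / 2 : ℝ) /
          Real.sqrt (Literature.Barriers.MatrixMultiplication.secondCharDegree
            (Matrix.GeneralLinearGroup (Fin n) (ZMod p)) : ℝ) +
          Fintype.card (Matrix.GeneralLinearGroup (Fin n) (ZMod p)) := h32
    _ ≤ (p : ℝ) ^ ((3 : ℝ) * (n : ℝ) ^ 2 / 2 - ((n : ℝ) - 1) / 2) +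
          (p : ℝ) ^ ((3 : ℝ) * (n : ℝ) ^ 2 / 2 - ((n : ℝ) - 1) / 2) := add_le_add h1 h2
    _ = 2 * (p : ℝ) ^ ((3 : ℝ) * (n : ℝ) ^ 2 / 2 - ((n : ℝ) - 1) / 2) := by ring

end Summit.MatrixMultiplication.MatrixMultiplication.Theorems.BorderHalfDimensionDesigns
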